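import Summits.AtomisticToContinuum.HydrodynamicLimit.Theses.SpeedCapSurgery
import Summits.AtomisticToContinuum.HydrodynamicLimit.Theses.SpacetimeExtensivity
import Summits.AtomisticToContinuum.HydrodynamicLimit.Theses.CornersLogPrice
import Literature.Barriers.AtomisticToContinuum.HighMomentumCutoff

/-!
# Strategist r1 sketch — crux `MaxSpeedBoundLog` (stmt-AtomisticToContinuum-9629)

Kernel-checked objects behind `STRATEGY-CENSUS.md` §R1 (crux-strategist REDIRECT seat
planner-cstrat-stmt-AtomisticToContinuum-9629-r1-0, 2026-08-17). Nothing here is a route item and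
nothing is a registered line. No `sorry`.

* §0  The two edges that place the crux AS TYPED at or above statements the portfolio has already
  set aside: `MaxSpeedBoundLog → SpacetimeExtensivity.MaxSpeedBound` (item stmt-3922, closed MOOT
  "suspect-false as typed": its `∀ t ≥ 0` frame is hit by post-collapse Guderley focusing) and
  `MaxSpeedBoundLog → CornersLogPrice.MaxSpeedBoundPreShock` (item stmt-9511, OPEN, wanted by three
  routes). The only analysis is `C·√log(N+2) ≤ (N+1)^{1/24}` eventually.
* §1  STRENGTHEN lens: the Euler-guarded Gaussian moment bound `GuardedHighMomentumCutoff σ`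
  (Nachtergaele–Yau II.1 with the smooth-Euler horizon restored) and the bookkeeping
  `HighMomentumCutoff σ → GuardedHighMomentumCutoff σ`.
* §2  TRANSFER lens (Kac / Povzner moment propagation): the typed target of the transfer,
  `PolynomialMomentPropagation σ q` (Heydecker 2019 Prop. 2 / Norris 2016 shape, written for the
  deterministic flow and the local Gibbs law), and `GaussianScaleMomentPropagation σ` (the `p!`-growth
  version the `√log N` cap actually needs).
-/

namespace Summit.AtomisticToContinuum.HydrodynamicLimit.Cruxes.MaxSpeedBoundLog.StrategistR1

open MeasureTheory Filter Set Topology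
open scoped ENNReal
open Literature.MathematicalPhysics.KineticTheory Literature.Analysis.FluidPDE
open Literature.Barriers.AtomisticToContinuum
open Summit.AtomisticToContinuum.HydrodynamicLimit.Theses.SpeedCapSurgery

/-! ## §0  The crux as typed dominates the mooted 3922 and the open 9511 -/

/-- Elementary growth comparison: for every real `C`, eventually in `N`,
`C · √(log (N+2)) ≤ (N+1)^{1/24}`. -/
theorem eventually_mul_sqrt_log_le_rpow (C : ℝ) :
    ∀ᶠ N : ℕ in atTop,
      C * Real.sqrt (Real.log ((N : ℝ) + 2)) ≤ ((N + 1 : ℕ) : ℝ) ^ (1 / 24 : ℝ) := by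
  have h1 : Tendsto (fun N : ℕ => ((N + 1 : ℕ) : ℝ)) atTop atTop :=
    tendsto_natCast_atTop_atTop.comp (tendsto_add_atTop_nat 1)
  have hT : Tendsto (fun N : ℕ => ((N + 1 : ℕ) : ℝ) ^ (1 / 24 : ℝ)) atTop atTop :=
    (tendsto_rpow_atTop (by norm_num : (0 : ℝ) < 1 / 24)).comp h1
  filter_upwards [hT.eventually_ge_atTop (25 * C ^ 2 + 1)] with N hN
  have hx : ((N + 1 : ℕ) : ℝ) = (N : ℝ) + 1 := by push_cast; ring
  rw [hx] at hN ⊢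
  have hx0 : (0 : ℝ) < (N : ℝ) + 1 := by positivity
  have hy0 : (0 : ℝ) ≤ ((N : ℝ) + 1) ^ (1 / 24 : ℝ) := Real.rpow_nonneg hx0.le _
  -- log (N+1) ≤ 24 · (N+1)^{1/24}
  have hlogx : Real.log ((N : ℝ) + 1) ≤ 24 * ((N : ℝ) + 1) ^ (1 / 24 : ℝ) := by
    have h := Real.log_le_rpow_div hx0.le (by norm_num : (0 : ℝ) < 1 / 24)
    have h' : ((N : ℝ) + 1) ^ (1 / 24 : ℝ) / (1 / 24 : ℝ) = 24 * ((N : ℝ) + 1) ^ (1 / 24 : ℝ) := by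
      ring
    rw [h'] at h
    exact h
  -- log (N+2) ≤ log 2 + log (N+1) ≤ 1 + 24 · (N+1)^{1/24}
  have hL : Real.log ((N : ℝ) + 2) ≤ 24 * ((N : ℝ) + 1) ^ (1 / 24 : ℝ) + 1 := by
    have h0 : (0 : ℝ) < (N : ℝ) + 2 := by positivity
    have hN2 : (N : ℝ) + 2 ≤ 2 * ((N : ℝ) + 1) := by
      have : (0 : ℝ) ≤ (N : ℝ) := Nat.cast_nonneg N
      linarith
    have h2 : Real.log 2 ≤ 1 := by
      have := Real.log_le_sub_one_of_pos (by norm_num : (0 : ℝ) < 2)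
      linarith
    calc Real.log ((N : ℝ) + 2) ≤ Real.log (2 * ((N : ℝ) + 1)) := Real.log_le_log h0 hN2
      _ = Real.log 2 + Real.log ((N : ℝ) + 1) := Real.log_mul two_ne_zero hx0.ne'
      _ ≤ 24 * ((N : ℝ) + 1) ^ (1 / 24 : ℝ) + 1 := by linarith
  by_cases hC : C ≤ 0
  · have hs : 0 ≤ Real.sqrt (Real.log ((N : ℝ) + 2)) := Real.sqrt_nonneg _
    calc C * Real.sqrt (Real.log ((N : ℝ) + 2)) ≤ 0 := by nlinarith
      _ ≤ ((N : ℝ) + 1) ^ (1 / 24 : ℝ) := hy0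
  · push Not at hC
    set y : ℝ := ((N : ℝ) + 1) ^ (1 / 24 : ℝ) with hy
    have hy1 : (1 : ℝ) ≤ y := by nlinarith [sq_nonneg C]
    have hsq : C ^ 2 * Real.log ((N : ℝ) + 2) ≤ y ^ 2 := by
      nlinarith [mul_le_mul_of_nonneg_left hL (sq_nonneg C),
        mul_le_mul_of_nonneg_right hN hy0, sq_nonneg C,
        mul_nonneg (sq_nonneg C) (sub_nonneg.2 hy1)]
    calc C * Real.sqrt (Real.log ((N : ℝ) + 2))
        = Real.sqrt (C ^ 2) * Real.sqrt (Real.log ((N : ℝ) + 2)) := by rw [Real.sqrt_sq hC.le]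
      _ = Real.sqrt (C ^ 2 * Real.log ((N : ℝ) + 2)) := (Real.sqrt_mul (sq_nonneg C) _).symm
      _ ≤ Real.sqrt (y ^ 2) := Real.sqrt_le_sqrt hsq
      _ = y := Real.sqrt_sq hy0

/-- **The crux as typed implies the mooted `SpacetimeExtensivity.MaxSpeedBound` (stmt-3922).**
Same profiles, same `σ₀`, same `∀ t ≥ 0` frame; the `(N+1)^{1/24}`-exceedance event is eventually
contained in the `C√log(N+2)`-exceedance event. Since 3922 was closed MOOT as suspect-false in
exactly this frame (post-shock Guderley focusing), the crux inherits the suspicion verbatim. -/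
theorem maxSpeedBoundLog_imp_maxSpeedBound3922 (h : MaxSpeedBoundLog) :
    Theses.SpacetimeExtensivity.MaxSpeedBound := by
  intro a₀ θ₀ u₀ ha hθ hu ha0 hθ0
  obtain ⟨σ₀, hσ₀, hσ⟩ := h a₀ θ₀ u₀ ha hθ hu ha0 hθ0
  refine ⟨σ₀, hσ₀, fun σ hσp hσl t ht Φ => ?_⟩
  obtain ⟨C, hC⟩ := hσ σ hσp hσl t ht Φ
  refine tendsto_of_tendsto_of_tendsto_of_le_of_le' tendsto_const_nhds hC
    (Eventually.of_forall fun _ => zero_le) ?_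
  filter_upwards [eventually_mul_sqrt_log_le_rpow C] with N hN
  refine measure_mono ?_
  rintro z ⟨r, hr, i, hi⟩
  exact ⟨r, hr, i, lt_of_le_of_lt hN hi⟩

/-- **The crux as typed implies the open pre-shock crux `CornersLogPrice.MaxSpeedBoundPreShock`
(stmt-9511, wanted by CornersLogPrice / SinaiSteeringDichotomy / SuperextensiveClosureCost).** The
Euler-solution and LLN hypotheses of 9511 are simply not used: the crux is 9511 PLUS the
post-shock surplus. -/
theorem maxSpeedBoundLog_imp_maxSpeedBoundPreShock9511 (h : MaxSpeedBoundLog) :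
    Theses.CornersLogPrice.MaxSpeedBoundPreShock := by
  intro a₀ θ₀ u₀ ha hθ hu ha0 hθ0
  obtain ⟨σ₀, hσ₀, hσ⟩ := h a₀ θ₀ u₀ ha hθ hu ha0 hθ0
  refine ⟨σ₀, hσ₀, fun σ hσp hσl T ρ θ u _hE Φ _hLLN t ht => ?_⟩
  obtain ⟨C, hC⟩ := hσ σ hσp hσl t ht.1 Φ
  refine tendsto_of_tendsto_of_tendsto_of_le_of_le' tendsto_const_nhds hC
    (Eventually.of_forall fun _ => zero_le) ?_
  filter_upwards [eventually_mul_sqrt_log_le_rpow C] with N hN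
  refine measure_mono ?_
  rintro z ⟨r, hr, i, hi⟩
  exact ⟨r, hr, i, lt_of_le_of_lt hN hi⟩

/-! ## §1  STRENGTHEN lens: the Euler-guarded Gaussian moment (NY II.1 with its horizon restored) -/

/-- **Guarded high-momentum cutoff** `S⁺`: Nachtergaele–Yau's Assumption II.1 transcribed to hard
spheres (`HighMomentumCutoff σ` of the barrier file) but asserted only on `[0, T)` along a classical
hard-sphere Euler solution matched by the local-Gibbs LLN at `t = 0` — the horizon in which NY
state II.1 (`t ≤ T₀/ε`, `T₀` inside the smooth regime) and the only frame `closes` consumes. By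
Chebyshev (NY Lemma 3.2) it gives the fixed-time one-body cap at level `C√log(N+2)` for
`c·C² > 1`; it is the barrier's missing input itself, not a step below it.
[cite: NachtergaeleYau2003, §2.3 Assumption II.1 and §3.2 Lemma 3.2] -/
def GuardedHighMomentumCutoff (σ : ℝ) : Prop :=
  ∀ (a₀ θ₀ : T3 → ℝ) (u₀ : T3 → V3), Continuous a₀ → Continuous θ₀ → Continuous u₀ →
    (∀ x, 0 < a₀ x) → (∀ x, 0 < θ₀ x) →
    ∀ (T : ℝ) (ρ θ : ℝ → T3 → ℝ) (u : ℝ → T3 → V3), IsHardSphereEulerSolution σ T ρ u θ →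
      ∀ Φ : (N : ℕ) → HardSphereFlow (Torus.geometry (Fin 3)) (hsDiameter σ N) (N + 1),
        TendstoHydroFieldsAt (fun N => localGibbsLaw σ a₀ u₀ θ₀ N (Φ N)) Φ ρ u θ 0 →
          ∃ c : ℝ, 0 < c ∧ ∃ C : ℝ≥0∞, C < ∞ ∧ ∀ N : ℕ, ∀ t ∈ Ico 0 T,
            ∫⁻ z, expVelocityMoment c ((Φ N).flow t z) ∂(localGibbsLaw σ a₀ u₀ θ₀ N (Φ N)) ≤ C

/-- Bookkeeping: the barrier file's unguarded hypothesis implies the guarded one (drop the Euler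
solution and the LLN; an empty horizon `T ≤ 0` is vacuous). The converse is the honest open
content; the unguarded `∀ T` form shares the crux's post-focus defect.
[cite: NachtergaeleYau2003, §2.3 Assumption II.1] -/
theorem guardedHighMomentumCutoff_of_highMomentumCutoff {σ : ℝ} (h : HighMomentumCutoff σ) :
    GuardedHighMomentumCutoff σ := by
  intro a₀ θ₀ u₀ ha hθ hu ha0 hθ0 T ρ θ u _hE Φ _hLLN
  by_cases hT : 0 < T
  · obtain ⟨c, hc, C, hC, hb⟩ := h a₀ θ₀ u₀ ha hθ hu ha0 hθ0 T hT Φ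
    exact ⟨c, hc, C, hC, fun N t ht => hb N t ⟨ht.1, ht.2.le⟩⟩
  · refine ⟨1, one_pos, 0, ENNReal.zero_lt_top, fun N t ht => ?_⟩
    exact absurd (ht.1.trans_lt ht.2) hT

/-! ## §2  TRANSFER lens: Kac / Povzner moment propagation, typed on the deterministic flow -/

/-- **Polynomial moment propagation along the hard-sphere flow** (the deterministic-flow
transcription of Norris 2016 / Heydecker 2019 Prop. 2(i) for the `N`-particle hard-spheres KAC
process, where it is a theorem uniform in `N`): the expected empirical moment
`(N+1)⁻¹ ∑ᵢ (1 + |vᵢ(t)|²)^{q/2}` under the local Gibbs law stays bounded on `[0, T]`. In the Kac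
process the proof is Povzner's inequality AVERAGED over the uniformly distributed impact direction;
for the deterministic flow the impact direction at a collision is a function of the configuration
and its conditional law at contact under the time-`t` law is exactly the two-body information the
crux lacks. Even granted, a fixed `q` caps the maximum only at `N^{1/q}`.
[cite: Heydecker2019, Prop. 2(i)] [cite: MischlerMouhot2013, Thm 6.2] -/
def PolynomialMomentPropagation (σ q : ℝ) : Prop :=
  ∀ (a₀ θ₀ : T3 → ℝ) (u₀ : T3 → V3), Continuous a₀ → Continuous θ₀ → Continuous u₀ →
    (∀ x, 0 < a₀ x) → (∀ x, 0 < θ₀ x) → ∀ T : ℝ, 0 < T →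
    ∀ Φ : (N : ℕ) → HardSphereFlow (Torus.geometry (Fin 3)) (hsDiameter σ N) (N + 1),
      ∃ K : ℝ≥0∞, K < ∞ ∧ ∀ N : ℕ, ∀ t ∈ Icc 0 T,
        ∫⁻ z, ENNReal.ofReal (((N : ℝ) + 1)⁻¹ *
            ∑ i, (1 + ‖((Φ N).flow t z i).2‖ ^ 2) ^ (q / 2)) ∂(localGibbsLaw σ a₀ u₀ θ₀ N (Φ N)) ≤ K

/-- **Gaussian-scale moment propagation** (what the `√log N` cap needs from the moment method:
ALL even moments with factorial growth, `E[(N+1)⁻¹∑ᵢ|vᵢ(t)|^{2p}] ≤ K · p! · (2θ⋆)^p` uniformly in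
`p`, `N`, `t ≤ T` — equivalent, up to constants, to the Gaussian moment `HighMomentumCutoff σ`;
Bobylev's `Σ`-Povzner estimate gives exactly this factorial structure for the homogeneous Boltzmann
EQUATION with hard spheres). [cite: Bobylev1997, Thm 3] -/
def GaussianScaleMomentPropagation (σ : ℝ) : Prop :=
  ∀ (a₀ θ₀ : T3 → ℝ) (u₀ : T3 → V3), Continuous a₀ → Continuous θ₀ → Continuous u₀ →
    (∀ x, 0 < a₀ x) → (∀ x, 0 < θ₀ x) → ∀ T : ℝ, 0 < T →
    ∀ Φ : (N : ℕ) → HardSphereFlow (Torus.geometry (Fin 3)) (hsDiameter σ N) (N + 1),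
      ∃ K θs : ℝ, 0 < θs ∧ ∀ p : ℕ, ∀ N : ℕ, ∀ t ∈ Icc 0 T,
        ∫⁻ z, ENNReal.ofReal (((N : ℝ) + 1)⁻¹ *
            ∑ i, ‖((Φ N).flow t z i).2‖ ^ (2 * p)) ∂(localGibbsLaw σ a₀ u₀ θ₀ N (Φ N))
          ≤ ENNReal.ofReal (K * (Nat.factorial p : ℝ) * (2 * θs) ^ p)

end Summit.AtomisticToContinuum.HydrodynamicLimit.Cruxes.MaxSpeedBoundLog.StrategistR1
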